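import Summits.Ventures.QEC.Thresholds.OptimalToricThresholds
import Literature.InformationTheory.QuantumCodes.CSSPhenomenologicalConverse
import HarnessLib

/-!
# Q5 packaging: decoder-free (OPTIMAL) PHENOMENOLOGICAL thresholds of the census CSS families — transfer of every
# certified floor, the `k ≥ 1` ceilings `p₀^{ph,Z,opt} + p₀^{ph,X,opt} ≤ 1/2`, and monotonicity in `p` (`q = p`)

Venture QEC, LADDER-QEC rung Q5 (qec-lit-2 gen 5). Companion of `OptimalDecoderThresholds.lean` (code capacity) and
`OptimalToricThresholds.lean` for the `T_i`-round memory experiment with noisy syndrome measurement at the isotropic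
rates `q = p` (`CSSFamilyThresholds.zPhenomFailureFamily`; perfect closing round, Dennis et al. §5).

* `zOptimalPhenomFailureFamily C T` / `xOptimalPhenomFailureFamily C T`: for the `i`-th code, the least failure
  probability over ALL space-time decoders (`Decoder.optimalFailureMass`, attained by maximum-likelihood decoding of
  the space-time syndrome, `MaximumLikelihoodDecoding.lean`); `zPhenomFailureFamily_eq_failureMass` is the
  definitional bridge to the census family;
* `z/x_phenom_accuracyThreshold_le_optimal` (DKLP §4.7, phenomenological form): the accuracy threshold of ANY
  space-time decoder family is at most the optimal one; every certified floor transfers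
  (`z_phenom_optimal_isThresholdLowerBound_of`);
* `z_phenom_optimal_threshold_le_half`, `phenom_optimal_thresholds_add_le_half` (+ accuracy-threshold form): the
  `k ≥ 1` ceilings of `CSSPhenomenologicalConverse.lean` hold for the optimal families (`T_i ≥ 1`);
* at `q = p` the space-time weight is the i.i.d. weight on the fault locations (`ToricCode.phenomenologicalWeight_self`),
  so BSC degradation (`OptimalDecodingMonotone.lean`) applies: `zOptimalPhenomFailureFamily_mono`, the
  below-threshold rates form an initial segment of `[0, 1/2]` and `p' ≤ accuracyThreshold` for every below-threshold
  `p' ≤ 1/2` (`z_phenom_optimal_le_accuracyThreshold_of_belowThreshold`); the same for the lattice toric family of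
  `OptimalToricThresholds.lean` (`toricOptimalPhenomFailureFamily_mono`,
  `toric_phenom_optimal_le_accuracyThreshold_of_belowThreshold`).

No new hypothesis-level fact; every theorem is proved from the tree (axioms standard).

## References

* [DennisEtAl2002] E. Dennis, A. Kitaev, A. Landahl, J. Preskill, J. Math. Phys. 43 (2002) 4452, §4.3 (optimal
  recovery), §4.6–4.7 (p_c; any method gives a lower bound), §5.2–5.3 (Prob_fail, p = q).
* [BravyiSucharaVargo2014] S. Bravyi, M. Suchara, A. Vargo, Phys. Rev. A 90 (2014) 032326, §1–2 (MLD is optimal).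
* [RichardsonUrbanke2008] T. Richardson, R. Urbanke, *Modern Coding Theory*, CUP 2008, Def. 4.69, Ex. 4.71, L4.78.
* [StaceBarrettDoherty2009] T. M. Stace, S. D. Barrett, A. C. Doherty, PRL 102 (2009) 200501, p. 2 (no-cloning bound).
-/

noncomputable section

namespace Summit.Ventures.QEC.Thresholds

open Filter Topology Finset Matrix
open Literature.InformationTheory.QuantumCodes
open Literature.InformationTheory.QuantumCodes.CSSPhenom

section CSSFamilies

variable {RX RZ Q : ℕ → Type*} [∀ i, Fintype (Q i)] [∀ i, DecidableEq (Q i)] [∀ i, Fintype (RX i)]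
  [∀ i, Fintype (RZ i)]

/-! ### The optimal phenomenological families -/

/-- **Optimal `Z`-sector phenomenological family** (`q = p`, `T i` rounds): the least failure probability over ALL
space-time decoders of the noisy `X`-syndrome record. [cite: DennisEtAl2002, §4.3 (optimal recovery) and §5.2–5.3] -/
def zOptimalPhenomFailureFamily [∀ i, DecidableEq (RX i)] (C : ∀ i, CSSCode (RX i) (RZ i) (Q i)) (T : ℕ → ℕ) :
    ℕ → ℝ → ℝ :=
  fun i p => Decoder.optimalFailureMass
    (fun E : History (RX i) (Q i) (T i) => phenomenologicalWeight (T i) p p (supp E))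
    (stSyn (C i).HX (T i)) (stTrivial ((C i).rowSpZ : Set (Q i → ZMod 2)) (T i))

/-- **Optimal `X`-sector phenomenological family** (`q = p`; noisy `Z`-syndrome record, bit flips).
[cite: DennisEtAl2002, §4.3 and §5.2–5.3] -/
def xOptimalPhenomFailureFamily [∀ i, DecidableEq (RZ i)] (C : ∀ i, CSSCode (RX i) (RZ i) (Q i)) (T : ℕ → ℕ) :
    ℕ → ℝ → ℝ :=
  fun i p => Decoder.optimalFailureMass
    (fun E : History (RZ i) (Q i) (T i) => phenomenologicalWeight (T i) p p (supp E))
    (stSyn (C i).HZ (T i)) (stTrivial ((C i).rowSpX : Set (Q i → ZMod 2)) (T i))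

/-- The optimal `X`-family is the optimal `Z`-family of the exchanged codes (definitional).
[cite: DennisEtAl2002, §5.2–5.3 (the two defect types are treated identically)] -/
theorem xOptimalPhenomFailureFamily_eq_swap [∀ i, DecidableEq (RZ i)] (C : ∀ i, CSSCode (RX i) (RZ i) (Q i)) (T : ℕ → ℕ) :
    xOptimalPhenomFailureFamily C T = zOptimalPhenomFailureFamily (fun i => (C i).swap) T := rfl

open Classical in
/-- The census phenomenological family is the abstract failure mass of its space-time decoder (definitional bridge).
[cite: DennisEtAl2002, §5.2 (Prob_fail)] -/
theorem zPhenomFailureFamily_eq_failureMass [∀ i, DecidableEq (RX i)] (C : ∀ i, CSSCode (RX i) (RZ i) (Q i))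
    (T : ℕ → ℕ) (D : ∀ i, STDecoder (RX i) (Q i) (T i)) (i : ℕ) (p : ℝ) :
    zPhenomFailureFamily C T D i p =
      Decoder.failureMass (fun E : History (RX i) (Q i) (T i) => phenomenologicalWeight (T i) p p (supp E))
        (stSyn (C i).HX (T i)) (stTrivial ((C i).rowSpZ : Set (Q i → ZMod 2)) (T i)) (D i) :=
  rfl

/-- **No space-time decoder family beats the optimal phenomenological family** (`Z`-sector, pointwise).
[cite: BravyiSucharaVargo2014, §1 (MLD is the optimal error correction algorithm)] -/
theorem zOptimalPhenomFailureFamily_le [∀ i, DecidableEq (RX i)] (C : ∀ i, CSSCode (RX i) (RZ i) (Q i)) (T : ℕ → ℕ)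
    (D : ∀ i, STDecoder (RX i) (Q i) (T i)) (i : ℕ) (p : ℝ) :
    zOptimalPhenomFailureFamily C T i p ≤ zPhenomFailureFamily C T D i p := by
  rw [zPhenomFailureFamily_eq_failureMass]
  exact Decoder.optimalFailureMass_le _ _ _ (D i)

/-- **No space-time decoder family beats the optimal phenomenological family** (`X`-sector, pointwise).
[cite: BravyiSucharaVargo2014, §1] -/
theorem xOptimalPhenomFailureFamily_le [∀ i, DecidableEq (RZ i)] (C : ∀ i, CSSCode (RX i) (RZ i) (Q i)) (T : ℕ → ℕ)
    (D : ∀ i, STDecoder (RZ i) (Q i) (T i)) (i : ℕ) (p : ℝ) :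
    xOptimalPhenomFailureFamily C T i p ≤ xPhenomFailureFamily C T D i p := by
  rw [xOptimalPhenomFailureFamily_eq_swap, xPhenomFailureFamily_eq_swap]
  exact zOptimalPhenomFailureFamily_le _ T D i p

/-- The optimal phenomenological family is attained, rate by rate, by (maximum-likelihood) space-time decoders.
[cite: BravyiSucharaVargo2014, §2 (ML Decoder)] -/
theorem exists_zPhenomFailureFamily_eq_optimal [∀ i, DecidableEq (RX i)] (C : ∀ i, CSSCode (RX i) (RZ i) (Q i)) (T : ℕ → ℕ) (p : ℝ) :
    ∃ D : ∀ i, STDecoder (RX i) (Q i) (T i), ∀ i, zPhenomFailureFamily C T D i p = zOptimalPhenomFailureFamily C T i p := by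
  have h := fun i => Decoder.exists_failureMass_eq_optimal
    (fun E : History (RX i) (Q i) (T i) => phenomenologicalWeight (T i) p p (supp E))
    (stSyn (C i).HX (T i)) (stTrivial ((C i).rowSpZ : Set (Q i → ZMod 2)) (T i))
  choose D _ hD using h
  exact ⟨D, fun i => by rw [zPhenomFailureFamily_eq_failureMass]; exact hD i⟩

/-- `0 ≤` the optimal phenomenological family on `[0, 1]`. [cite: DennisEtAl2002, §5.2 (Prob_fail)] -/
theorem zOptimalPhenomFailureFamily_nonneg [∀ i, DecidableEq (RX i)] (C : ∀ i, CSSCode (RX i) (RZ i) (Q i)) (T : ℕ → ℕ) (i : ℕ) {p : ℝ}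
    (hp0 : 0 ≤ p) (hp1 : p ≤ 1) : 0 ≤ zOptimalPhenomFailureFamily C T i p :=
  Decoder.optimalFailureMass_nonneg _ _ fun E => phenomenologicalWeight_nonneg' (T i) hp0 hp1 hp0 hp1 (supp E)

/-- `0 ≤` the optimal `X`-family on `[0, 1]`. [cite: DennisEtAl2002, §5.2 (Prob_fail)] -/
theorem xOptimalPhenomFailureFamily_nonneg [∀ i, DecidableEq (RZ i)] (C : ∀ i, CSSCode (RX i) (RZ i) (Q i)) (T : ℕ → ℕ) (i : ℕ) {p : ℝ}
    (hp0 : 0 ≤ p) (hp1 : p ≤ 1) : 0 ≤ xOptimalPhenomFailureFamily C T i p := by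
  rw [xOptimalPhenomFailureFamily_eq_swap]
  exact zOptimalPhenomFailureFamily_nonneg _ T i hp0 hp1

/-! ### DKLP §4.7, phenomenological form: every decoder family's threshold is a floor for the optimal one -/

/-- **Every certified phenomenological `Z`-threshold lower bound `a ≤ 1` of any space-time decoder family is one for
the optimal family.** [cite: DennisEtAl2002, §4.7 (a lower bound on p_c) and §5.3] -/
theorem z_phenom_optimal_isThresholdLowerBound_of [∀ i, DecidableEq (RX i)] (C : ∀ i, CSSCode (RX i) (RZ i) (Q i)) (T : ℕ → ℕ)
    (D : ∀ i, STDecoder (RX i) (Q i) (T i)) {a : ℝ} (ha : IsThresholdLowerBound (zPhenomFailureFamily C T D) a)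
    (ha1 : a ≤ 1) : IsThresholdLowerBound (zOptimalPhenomFailureFamily C T) a :=
  isThresholdLowerBound_of_le (fun i _ hp0 hp1 => zOptimalPhenomFailureFamily_nonneg C T i hp0 hp1)
    (fun i p _ _ => zOptimalPhenomFailureFamily_le C T D i p) ha ha1

/-- **DKLP §4.7, phenomenological `Z`-sector**: `accuracyThreshold (zPhenomFailureFamily C T D) ≤
accuracyThreshold (zOptimalPhenomFailureFamily C T)` for EVERY space-time decoder family `D`.
[cite: DennisEtAl2002, §4.7 (provides a lower bound on p_c) and §5.3 (p = q)] -/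
theorem z_phenom_accuracyThreshold_le_optimal [∀ i, DecidableEq (RX i)] (C : ∀ i, CSSCode (RX i) (RZ i) (Q i)) (T : ℕ → ℕ)
    (D : ∀ i, STDecoder (RX i) (Q i) (T i)) :
    accuracyThreshold (zPhenomFailureFamily C T D) ≤ accuracyThreshold (zOptimalPhenomFailureFamily C T) :=
  accuracyThreshold_le_of_le (fun i _ hp0 hp1 => zOptimalPhenomFailureFamily_nonneg C T i hp0 hp1)
    fun i p _ _ => zOptimalPhenomFailureFamily_le C T D i p

/-- **DKLP §4.7, phenomenological `X`-sector.** [cite: DennisEtAl2002, §4.7 and §5.3] -/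
theorem x_phenom_accuracyThreshold_le_optimal [∀ i, DecidableEq (RZ i)] (C : ∀ i, CSSCode (RX i) (RZ i) (Q i)) (T : ℕ → ℕ)
    (D : ∀ i, STDecoder (RZ i) (Q i) (T i)) :
    accuracyThreshold (xPhenomFailureFamily C T D) ≤ accuracyThreshold (xOptimalPhenomFailureFamily C T) :=
  accuracyThreshold_le_of_le (fun i _ hp0 hp1 => xOptimalPhenomFailureFamily_nonneg C T i hp0 hp1)
    fun i p _ _ => xOptimalPhenomFailureFamily_le C T D i p

/-! ### The `k ≥ 1` ceilings hold for the optimal space-time decoders -/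

/-- **`p₀^{ph,Z,opt} ≤ 1/2`** (`k ≥ 1`, rounds `T_i ≥ 1`): at flip rate `1/2` even maximum-likelihood space-time
decoding fails with probability `≥ 1/2`. [cite: DennisEtAl2002, §4.6 (p_c) and §5.3; RichardsonUrbanke2008, Lemma 4.78] -/
theorem z_phenom_optimal_threshold_le_half [∀ i, DecidableEq (RX i)] (C : ∀ i, CSSCode (RX i) (RZ i) (Q i)) (hk : ∀ i, 0 < (C i).k)
    (T : ℕ → ℕ) (hT : ∀ i, 0 < T i) {a : ℝ} (ha : IsThresholdLowerBound (zOptimalPhenomFailureFamily C T) a) :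
    a ≤ 1 / 2 := by
  by_contra h
  push Not at h
  refine not_belowThreshold_of_le (c := 1 / 2) (by norm_num) (fun i => ?_) (ha (1 / 2) (by norm_num) h)
  obtain ⟨D, hD⟩ := exists_zPhenomFailureFamily_eq_optimal C T (1 / 2)
  rw [← hD i]
  exact (C i).half_le_zPhenom_half (hk i) (D i) ⟨0, hT i⟩

/-- **THE PHENOMENOLOGICAL CONVERSE FOR THE OPTIMAL DECODERS**: for every CSS family with `k ≥ 1` and rounds
`T_i, T'_i ≥ 1`, certified lower bounds `a` (optimal `Z`) and `b` (optimal `X`) satisfy `a + b ≤ 1/2`.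
[cite: DennisEtAl2002, §4.6 and §5.3; StaceBarrettDoherty2009, p. 2 (no-cloning bound)] -/
theorem phenom_optimal_thresholds_add_le_half [∀ i, DecidableEq (RX i)] [∀ i, DecidableEq (RZ i)] (C : ∀ i, CSSCode (RX i) (RZ i) (Q i)) (hk : ∀ i, 0 < (C i).k)
    (T T' : ℕ → ℕ) (hT : ∀ i, 0 < T i) (hT' : ∀ i, 0 < T' i) {a b : ℝ}
    (ha : IsThresholdLowerBound (zOptimalPhenomFailureFamily C T) a)
    (hb : IsThresholdLowerBound (xOptimalPhenomFailureFamily C T') b) : a + b ≤ 1 / 2 := by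
  by_contra h
  push Not at h
  have hb' : b ≤ 1 / 2 := by
    rw [xOptimalPhenomFailureFamily_eq_swap] at hb
    exact z_phenom_optimal_threshold_le_half (fun i => (C i).swap) (fun i => by rw [CSSCode.k_swap]; exact hk i)
      T' hT' hb
  have ha' : a ≤ 1 / 2 := z_phenom_optimal_threshold_le_half C hk T hT ha
  set p : ℝ := (max 0 (1 / 2 - b) + a) / 2 with hp
  have hlow : max 0 (1 / 2 - b) < a := max_lt (by linarith) (by linarith)
  have hp0 : 0 ≤ p := by
    have : 0 ≤ max 0 (1 / 2 - b) := le_max_left _ _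
    rw [hp]; linarith
  have hpa : p < a := by rw [hp]; linarith
  have hpb : 1 / 2 - p < b := by
    have : 1 / 2 - b ≤ max 0 (1 / 2 - b) := le_max_right _ _
    rw [hp]; linarith
  have hp'0 : 0 ≤ 1 / 2 - p := by linarith
  have hZ := ha p hp0 hpa
  have hX := hb (1 / 2 - p) hp'0 hpb
  have hsum : Tendsto (fun i => zOptimalPhenomFailureFamily C T i p + xOptimalPhenomFailureFamily C T' i (1 / 2 - p))
      atTop (𝓝 0) := by
    simpa using hZ.add hX
  refine not_belowThreshold_of_le
    (P := fun i q => zOptimalPhenomFailureFamily C T i q + xOptimalPhenomFailureFamily C T' i (1 / 2 - q))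
    (p := p) (c := 1 / 2) (by norm_num) (fun i => ?_) hsum
  obtain ⟨DZ, hDZ⟩ := exists_zPhenomFailureFamily_eq_optimal C T p
  obtain ⟨DX, hDX⟩ := exists_zPhenomFailureFamily_eq_optimal (fun i => (C i).swap) T' (1 / 2 - p)
  show 1 / 2 ≤ zOptimalPhenomFailureFamily C T i p + xOptimalPhenomFailureFamily C T' i (1 / 2 - p)
  rw [xOptimalPhenomFailureFamily_eq_swap, ← hDZ i, ← hDX i]
  exact (C i).half_le_zPhenom_add_xPhenom (hk i) (DZ i) (DX i) ⟨0, hT i⟩ ⟨0, hT' i⟩ hp0 hp'0 (by ring)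

/-- Accuracy-threshold form: `p_c^{ph,Z,opt} + p_c^{ph,X,opt} ≤ 1/2` (`k ≥ 1`, `T_i, T'_i ≥ 1`).
[cite: DennisEtAl2002, §4.6 (p_c) and §5.3] -/
theorem phenom_optimal_accuracyThresholds_add_le_half [∀ i, DecidableEq (RX i)] [∀ i, DecidableEq (RZ i)] (C : ∀ i, CSSCode (RX i) (RZ i) (Q i))
    (hk : ∀ i, 0 < (C i).k) (T T' : ℕ → ℕ) (hT : ∀ i, 0 < T i) (hT' : ∀ i, 0 < T' i) :
    accuracyThreshold (zOptimalPhenomFailureFamily C T) + accuracyThreshold (xOptimalPhenomFailureFamily C T') ≤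
      1 / 2 :=
  phenom_optimal_thresholds_add_le_half C hk T T' hT hT' (isThresholdLowerBound_accuracyThreshold _)
    (isThresholdLowerBound_accuracyThreshold _)

/-! ### Monotonicity in `p` (BSC degradation on the space-time fault locations) -/

/-- **The optimal phenomenological family is non-decreasing in `p` on `[0, 1/2]`** (`q = p` tied): the space-time
weight is i.i.d. on the fault locations and the space-time boundary map is additive, so the degradation argument of
`OptimalDecodingMonotone.lean` applies verbatim. [cite: RichardsonUrbanke2008, Example 4.71; DennisEtAl2002, §4.7 and §5.3] -/
theorem zOptimalPhenomFailureFamily_mono [∀ i, DecidableEq (RX i)] (C : ∀ i, CSSCode (RX i) (RZ i) (Q i)) (T : ℕ → ℕ) (i : ℕ) {p p' : ℝ}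
    (hpp' : p ≤ p') (hp' : p' ≤ 1 / 2) :
    zOptimalPhenomFailureFamily C T i p ≤ zOptimalPhenomFailureFamily C T i p' := by
  have hw : ∀ r : ℝ, (fun E : History (RX i) (Q i) (T i) => phenomenologicalWeight (T i) r r (supp E)) =
      fun E => bernoulliWeight r (supp E) := fun r => funext fun E => ToricCode.phenomenologicalWeight_self _ _ _
  unfold zOptimalPhenomFailureFamily
  rw [hw p, hw p']
  exact Decoder.optimalFailureMass_flip_mono (fun a b => by simp [stSyn, Matrix.mulVec_add]) _ hpp' hp'

/-- **The optimal `X`-family is non-decreasing in `p` on `[0, 1/2]`.** [cite: RichardsonUrbanke2008, Example 4.71] -/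
theorem xOptimalPhenomFailureFamily_mono [∀ i, DecidableEq (RZ i)] (C : ∀ i, CSSCode (RX i) (RZ i) (Q i)) (T : ℕ → ℕ) (i : ℕ) {p p' : ℝ}
    (hpp' : p ≤ p') (hp' : p' ≤ 1 / 2) :
    xOptimalPhenomFailureFamily C T i p ≤ xOptimalPhenomFailureFamily C T i p' := by
  rw [xOptimalPhenomFailureFamily_eq_swap]
  exact zOptimalPhenomFailureFamily_mono _ T i hpp' hp'

/-- **Below-threshold rates of the optimal phenomenological family form an initial segment of `[0, 1/2]`.**
[cite: DennisEtAl2002, §4.3 (below threshold) with RichardsonUrbanke2008, Example 4.71] -/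
theorem z_phenom_optimal_belowThreshold_of_le [∀ i, DecidableEq (RX i)] (C : ∀ i, CSSCode (RX i) (RZ i) (Q i)) (T : ℕ → ℕ) {p p' : ℝ}
    (h : BelowThreshold (zOptimalPhenomFailureFamily C T) p') (hp0 : 0 ≤ p) (hpp' : p ≤ p') (hp' : p' ≤ 1 / 2) :
    BelowThreshold (zOptimalPhenomFailureFamily C T) p := by
  unfold BelowThreshold at h ⊢
  exact squeeze_zero (fun i => zOptimalPhenomFailureFamily_nonneg C T i hp0 (by linarith))
    (fun i => zOptimalPhenomFailureFamily_mono C T i hpp' hp') h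

/-- **A below-threshold rate `p' ≤ 1/2` bounds the optimal phenomenological threshold from below**:
`p' ≤ accuracyThreshold (zOptimalPhenomFailureFamily C T)` — for the optimal space-time decoder the phenomenological
`p_c` is a threshold in the strict sense. [cite: DennisEtAl2002, §4.3 and §4.6 (p_c), §5.3] -/
theorem z_phenom_optimal_le_accuracyThreshold_of_belowThreshold [∀ i, DecidableEq (RX i)] (C : ∀ i, CSSCode (RX i) (RZ i) (Q i)) (T : ℕ → ℕ)
    {p' : ℝ} (hp' : p' ≤ 1 / 2) (h : BelowThreshold (zOptimalPhenomFailureFamily C T) p') :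
    p' ≤ accuracyThreshold (zOptimalPhenomFailureFamily C T) :=
  le_accuracyThreshold (fun p hp0 hpp' => z_phenom_optimal_belowThreshold_of_le C T h hp0 hpp'.le hp') (by linarith)

end CSSFamilies

/-! ### The lattice toric code: monotone optimal phenomenological family -/

section Toric

open Literature.InformationTheory.QuantumCodes.ToricCode

variable {T : ℕ → ℕ}

/-- **The optimal phenomenological toric family is non-decreasing in `p` on `[0, 1/2]`** (`q = p`).
[cite: RichardsonUrbanke2008, Example 4.71; DennisEtAl2002, §5.3 (p = q)] -/
theorem toricOptimalPhenomFailureFamily_mono (L : ℕ) {p p' : ℝ} (hpp' : p ≤ p') (hp' : p' ≤ 1 / 2) :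
    toricOptimalPhenomFailureFamily T L p ≤ toricOptimalPhenomFailureFamily T L p' := by
  have hw : ∀ r : ℝ, (fun E : ToricCode.History (L + 1) (T L) => phenomenologicalWeight (T L) r r (supp E)) =
      fun E => bernoulliWeight r (supp E) := fun r => funext fun E => ToricCode.phenomenologicalWeight_self _ _ _
  unfold toricOptimalPhenomFailureFamily
  rw [hw p, hw p']
  exact Decoder.optimalFailureMass_flip_mono (fun a b => by simp [ToricCode.stSyn, Matrix.mulVec_add]) _ hpp' hp'

/-- **Below-threshold rates of the optimal phenomenological toric family form an initial segment of `[0, 1/2]`.**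
[cite: DennisEtAl2002, §4.3 and §5.3] -/
theorem toric_phenom_optimal_belowThreshold_of_le {p p' : ℝ} (h : BelowThreshold (toricOptimalPhenomFailureFamily T) p')
    (hp0 : 0 ≤ p) (hpp' : p ≤ p') (hp' : p' ≤ 1 / 2) : BelowThreshold (toricOptimalPhenomFailureFamily T) p := by
  unfold BelowThreshold at h ⊢
  exact squeeze_zero (fun L => toricOptimalPhenomFailureFamily_nonneg L hp0 (by linarith))
    (fun L => toricOptimalPhenomFailureFamily_mono L hpp' hp') h

/-- **The phenomenological toric `p_c` is a threshold in the strict sense for the optimal decoder**: every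
below-threshold `p' ≤ 1/2` is `≤ accuracyThreshold (toricOptimalPhenomFailureFamily T)`.
[cite: DennisEtAl2002, §4.6 (p_c) and §5.3] -/
theorem toric_phenom_optimal_le_accuracyThreshold_of_belowThreshold {p' : ℝ} (hp' : p' ≤ 1 / 2)
    (h : BelowThreshold (toricOptimalPhenomFailureFamily T) p') :
    p' ≤ accuracyThreshold (toricOptimalPhenomFailureFamily T) :=
  le_accuracyThreshold (fun p hp0 hpp' => toric_phenom_optimal_belowThreshold_of_le h hp0 hpp'.le hp') (by linarith)

end Toric

end Summit.Ventures.QEC.Thresholds
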